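import Literature.Analysis.FluidPDE.BesovCubicEstimate
import Literature.Analysis.FluidPDE.LocalTypeIMorreyProofs
import Literature.Analysis.FluidPDE.ClassicalSuitable
import Literature.Analysis.FluidPDE.SereginSverakPressureProofs
import Literature.Analysis.FunctionSpaces.BesovCriticalRescaling
import HarnessLib

/-!
# Wang–Zhang 2017, Lemma 4.1: uniform scale-invariant bounds for classical solutions bounded in a
# critical Besov space

Analysis/FluidPDE proof file (theorems only: no definition, no named fact). W. Wang, Z. Zhang,
*Blow-up of critical norms for the 3-D Navier–Stokes equations*, Sci. China Math. 60 (2017) =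
arXiv:1510.02589, **Lemma 4.1** with the first display of §4 Step 1 ((4.1)): for a smooth solution
on `ℝ³ × [0, T)` with `sup_t ‖u(t)‖_{Ḃ^{-1+3/p}_{p,q}} ≤ M`, `3 < p < ∞`, the scale-invariant
quantities `A, E, C, D` are bounded, uniformly over all apices `(t₀, x₀)` with `T/2 ≤ t₀ ≤ T` and
all small radii, by a constant depending on `M`, `T` and the energy data — here for the classical
Leray–Hopf solutions from finite-energy data of the continuation criterion
`hasSmoothExtensionPast_of_eHomBesovNorm_bounded`, with unit viscosity, the classical gradient in
`E` and the gauged pressure `q = p - c(t)` (`= p̃[u(t)]` a.e., `SereginSverakPressureProofs`) in `D`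
(`exists_scaledEnergies_bounded_of_classical_besov`).

Proof, following the printed one: the cubic estimate `C(r) ≤ K M (C(3r)^{2/3} + E(3r)^{1/2}C(3r)^{1/3})`
(`exists_cknC_le_of_eHomBesovNorm_le`, the tree's rendering of the first display of the proof of
Lemma 4.1), the local energy inequality `A + E ≤ c (C^{2/3} + C + D^{2/3}C^{1/3})`
(`localEnergyBound_top`) and Young's inequality give `C(r) ≤ δ (C(6r) + D(6r)) + c(δ, M)`
((4.2): "`C(u,r) ≤ C(M)(1 + C(u,4r) + D(π,4r))^{5/6}`", `le_delta_mul_add_of_cubic_estimate`); with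
the pressure decay estimate `D(ϱ) ≤ c ((ϱ/ρ) D(ρ) + (ρ/ϱ)² C(ρ))`
(`seregin_sverak_pressure_decay_holds`, the printed Lemma 2.4 in the form (4.4)) one contraction
step `F(θR/6) ≤ F(R)/2 + c` for `F = C + D` follows, and "a standard iterative scheme ensures that
`F(r) ≤ C(M, C(u,½), D(π,½))`" (`exists_bound_of_cubic_step_of_pressure_decay`); the top-scale
quantities are bounded by the slab integrals `∫∫ |u|³`, `∫∫ |q|^{3/2}` (finite for Leray–Hopf
classical solutions), uniformly in the apex; finally `A + E + C + D ≤ K` from the bounded `C` by the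
tree's `scaledEnergies_bounded_of_cknC_le_unif` (Seregin 2006, Lemma 2.1 (b)).

## References

* W. Wang, Z. Zhang, Sci. China Math. 60 (2017) 637–650 = arXiv:1510.02589, Lemma 4.1 and §4
  Step 1, (4.1)–(4.4). [WangZhang2016]
* G. Seregin, V. Šverák, Comm. PDE 34 (2009) = arXiv:0804.1803, proof of Lemma 3.5 (as13).
  [SereginSverak2009]
* G. Seregin, Zap. Nauchn. Sem. POMI 336 (2006) = arXiv:math/0607537, Lemma 2.1 (b).
  [Seregin2006]
-/

noncomputable section

open MeasureTheory TemperedDistribution Filter Set Function Metric TopologicalSpace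
open _root_.Topology
open scoped SchwartzMap ENNReal NNReal

namespace Literature.Analysis.FluidPDE

/-! ## A Young-type inequality `K s^{5/6} ≤ δ s + K⁶/δ⁵` in `ℝ≥0∞` -/

/-- `K s^{5/6} ≤ δ s + K⁶ δ⁻⁵` for `s ∈ [0, ∞]`, `δ > 0` (compare `s` with `(K/δ)⁶`). [folklore] -/
theorem coe_mul_rpow_five_sixths_le (K δ : ℝ≥0) (hδ : 0 < δ) (s : ℝ≥0∞) :
    (K : ℝ≥0∞) * s ^ (5 / 6 : ℝ) ≤ δ * s + ((K ^ 6 / δ ^ 5 : ℝ≥0) : ℝ≥0∞) := by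
  rcases eq_or_ne s ⊤ with rfl | hs
  · rw [ENNReal.mul_top (by exact_mod_cast hδ.ne')]
    exact le_top.trans le_self_add
  lift s to ℝ≥0 using hs
  rw [← ENNReal.coe_rpow_of_nonneg _ (by norm_num), ← ENNReal.coe_mul, ← ENNReal.coe_mul,
    ← ENNReal.coe_add, ENNReal.coe_le_coe]
  by_cases h : s ≤ (K / δ) ^ (6 : ℕ)
  · calc K * s ^ (5 / 6 : ℝ) ≤ K * ((K / δ) ^ (6 : ℕ)) ^ (5 / 6 : ℝ) := by gcongr
      _ = K * (K / δ) ^ (5 : ℕ) := by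
          rw [← NNReal.rpow_natCast, ← NNReal.rpow_mul, ← NNReal.rpow_natCast]
          norm_num
      _ = K ^ 6 / δ ^ 5 := by rw [div_pow]; field_simp
      _ ≤ δ * s + K ^ 6 / δ ^ 5 := le_add_self
  · push Not at h
    have hs6 : K / δ < s ^ (1 / 6 : ℝ) := by
      have h' := NNReal.rpow_lt_rpow h (by norm_num : (0 : ℝ) < 1 / 6)
      rwa [← NNReal.rpow_natCast, ← NNReal.rpow_mul,
        show ((6 : ℕ) : ℝ) * (1 / 6) = 1 by norm_num, NNReal.rpow_one] at h'
    have hK : K ≤ δ * s ^ (1 / 6 : ℝ) := by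
      rw [div_lt_iff₀ hδ] at hs6
      rw [mul_comm]
      exact hs6.le
    have hmain : K * s ^ (5 / 6 : ℝ) ≤ δ * s := by
      calc K * s ^ (5 / 6 : ℝ) ≤ (δ * s ^ (1 / 6 : ℝ)) * s ^ (5 / 6 : ℝ) := by gcongr
        _ = δ * (s ^ (1 / 6 : ℝ) * s ^ (5 / 6 : ℝ)) := by ring
        _ = δ * s := by
            rw [← NNReal.rpow_add' (by norm_num : (1 / 6 : ℝ) + 5 / 6 ≠ 0)]
            norm_num
    exact hmain.trans le_self_add

/-! ## The algebraic step `C(r) ≤ δ (C(6r) + D(6r)) + c(δ)` -/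

/-- `4^{2/3} ≤ 4` and `4^{1/3} ≤ 2` in `ℝ≥0∞`. [folklore] -/
theorem four_rpow_bounds : (4 : ℝ≥0∞) ^ (2 / 3 : ℝ) ≤ 4 ∧ (4 : ℝ≥0∞) ^ (1 / 3 : ℝ) ≤ 2 := by
  constructor
  · calc (4 : ℝ≥0∞) ^ (2 / 3 : ℝ) ≤ (4 : ℝ≥0∞) ^ (1 : ℝ) :=
          ENNReal.rpow_le_rpow_of_exponent_le (by norm_num) (by norm_num)
      _ = 4 := ENNReal.rpow_one _
  · rw [show (1 / 3 : ℝ) = (3 : ℝ)⁻¹ by norm_num, ENNReal.rpow_inv_le_iff (by norm_num : (0 : ℝ) < 3)]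
    rw [show (3 : ℝ) = ((3 : ℕ) : ℝ) by norm_num, ENNReal.rpow_natCast]
    norm_num

/-- **The algebraic heart of the iteration** (Wang–Zhang 2017, Lemma 4.1, (4.2) with Young's
inequality): if `C_r ≤ K'(C₃^{2/3} + E₃^{1/2} C₃^{1/3})`, `E₃ ≤ c₁ X^{2/3} + c₂ X + c₃ Y^{2/3} X^{1/3}`
and `C₃ ≤ 4 X` (read `C₃ = C(3r)`, `E₃ = E(3r)`, `X = C(6r)`, `Y = D(6r)`), then for every `δ > 0`,
`C_r ≤ δ (X + Y) + (δ + K''⁶/δ⁵)` with `K'' = K'(6 + 2(c₁ + c₂ + c₃))`. [cite: WangZhang2016, Lemma 4.1 (4.2)] -/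
theorem le_delta_mul_add_of_cubic_estimate {X Y C3 E3 Cr : ℝ≥0∞} {K' c₁ c₂ c₃ : ℝ≥0}
    (hC : Cr ≤ K' * (C3 ^ (2 / 3 : ℝ) + E3 ^ (1 / 2 : ℝ) * C3 ^ (1 / 3 : ℝ)))
    (hE : E3 ≤ c₁ * X ^ (2 / 3 : ℝ) + c₂ * X + c₃ * (Y ^ (2 / 3 : ℝ) * X ^ (1 / 3 : ℝ)))
    (hC3 : C3 ≤ 4 * X) {δ : ℝ≥0} (hδ : 0 < δ) :
    Cr ≤ δ * (X + Y) + ((δ : ℝ≥0∞) +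
      (((K' * (6 + 2 * (c₁ + c₂ + c₃))) ^ 6 / δ ^ 5 : ℝ≥0) : ℝ≥0∞)) := by
  set S : ℝ≥0∞ := 1 + X + Y with hSdef
  have hS1 : 1 ≤ S := by rw [hSdef, add_assoc]; exact le_self_add
  have hX : X ≤ S := by rw [hSdef, add_comm 1 X, add_assoc]; exact le_self_add
  have hY : Y ≤ S := le_add_self
  set c : ℝ≥0 := c₁ + c₂ + c₃ with hcdef
  -- powers of `S`
  have hSpow : ∀ {a b : ℝ}, a ≤ b → S ^ a ≤ S ^ b := fun hab =>
    ENNReal.rpow_le_rpow_of_exponent_le hS1 hab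
  have hS23 : S ^ (2 / 3 : ℝ) ≤ S := (hSpow (by norm_num : (2 / 3 : ℝ) ≤ 1)).trans (ENNReal.rpow_one S).le
  have hX23 : X ^ (2 / 3 : ℝ) ≤ S := (ENNReal.rpow_le_rpow hX (by norm_num)).trans hS23
  have hYX : Y ^ (2 / 3 : ℝ) * X ^ (1 / 3 : ℝ) ≤ S := by
    calc Y ^ (2 / 3 : ℝ) * X ^ (1 / 3 : ℝ) ≤ S ^ (2 / 3 : ℝ) * S ^ (1 / 3 : ℝ) :=
          mul_le_mul' (ENNReal.rpow_le_rpow hY (by norm_num)) (ENNReal.rpow_le_rpow hX (by norm_num))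
      _ = S := by
          rw [← ENNReal.rpow_add_of_nonneg _ _ (by norm_num) (by norm_num)]
          norm_num
  -- `E₃ ≤ c S`
  have hE' : E3 ≤ c * S := by
    refine hE.trans ?_
    calc c₁ * X ^ (2 / 3 : ℝ) + c₂ * X + c₃ * (Y ^ (2 / 3 : ℝ) * X ^ (1 / 3 : ℝ))
        ≤ c₁ * S + c₂ * S + c₃ * S := by gcongr
      _ = c * S := by rw [hcdef]; push_cast; ring
  -- `C₃^{2/3} ≤ 4 S^{5/6}` and `C₃^{1/3} ≤ 2 S^{1/3}`
  obtain ⟨h4a, h4b⟩ := four_rpow_bounds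
  have hC3S : C3 ≤ 4 * S := hC3.trans (mul_le_mul' le_rfl hX)
  have hC3_23 : C3 ^ (2 / 3 : ℝ) ≤ 4 * S ^ (5 / 6 : ℝ) := by
    calc C3 ^ (2 / 3 : ℝ) ≤ (4 * S) ^ (2 / 3 : ℝ) := ENNReal.rpow_le_rpow hC3S (by norm_num)
      _ = (4 : ℝ≥0∞) ^ (2 / 3 : ℝ) * S ^ (2 / 3 : ℝ) := ENNReal.mul_rpow_of_nonneg _ _ (by norm_num)
      _ ≤ 4 * S ^ (5 / 6 : ℝ) := mul_le_mul' h4a (hSpow (by norm_num))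
  have hC3_13 : C3 ^ (1 / 3 : ℝ) ≤ 2 * S ^ (1 / 3 : ℝ) := by
    calc C3 ^ (1 / 3 : ℝ) ≤ (4 * S) ^ (1 / 3 : ℝ) := ENNReal.rpow_le_rpow hC3S (by norm_num)
      _ = (4 : ℝ≥0∞) ^ (1 / 3 : ℝ) * S ^ (1 / 3 : ℝ) := ENNReal.mul_rpow_of_nonneg _ _ (by norm_num)
      _ ≤ 2 * S ^ (1 / 3 : ℝ) := mul_le_mul' h4b le_rfl
  -- `E₃^{1/2} C₃^{1/3} ≤ 2 (c + 1) S^{5/6}`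
  have hEC : E3 ^ (1 / 2 : ℝ) * C3 ^ (1 / 3 : ℝ) ≤ (2 * (c + 1) : ℝ≥0∞) * S ^ (5 / 6 : ℝ) := by
    -- `x^{1/2} ≤ x + 1` in `ℝ≥0∞`
    have hhalf : ∀ x : ℝ≥0∞, x ^ (1 / 2 : ℝ) ≤ x + 1 := by
      intro x
      rcases le_or_gt x 1 with hx | hx
      · exact (ENNReal.rpow_le_one hx (by norm_num)).trans le_add_self
      · calc x ^ (1 / 2 : ℝ) ≤ x ^ (1 : ℝ) := ENNReal.rpow_le_rpow_of_exponent_le hx.le (by norm_num)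
          _ = x := ENNReal.rpow_one x
          _ ≤ x + 1 := le_self_add
    have h1 : E3 ^ (1 / 2 : ℝ) ≤ (c + 1 : ℝ≥0∞) * S ^ (1 / 2 : ℝ) := by
      calc E3 ^ (1 / 2 : ℝ) ≤ ((c : ℝ≥0∞) * S) ^ (1 / 2 : ℝ) := ENNReal.rpow_le_rpow hE' (by norm_num)
        _ = (c : ℝ≥0∞) ^ (1 / 2 : ℝ) * S ^ (1 / 2 : ℝ) := ENNReal.mul_rpow_of_nonneg _ _ (by norm_num)
        _ ≤ (c + 1 : ℝ≥0∞) * S ^ (1 / 2 : ℝ) := mul_le_mul' (hhalf _) le_rfl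
    calc E3 ^ (1 / 2 : ℝ) * C3 ^ (1 / 3 : ℝ)
        ≤ ((c + 1 : ℝ≥0∞) * S ^ (1 / 2 : ℝ)) * (2 * S ^ (1 / 3 : ℝ)) := mul_le_mul' h1 hC3_13
      _ = (2 * (c + 1) : ℝ≥0∞) * (S ^ (1 / 2 : ℝ) * S ^ (1 / 3 : ℝ)) := by ring
      _ = (2 * (c + 1) : ℝ≥0∞) * S ^ (5 / 6 : ℝ) := by
          rw [← ENNReal.rpow_add_of_nonneg _ _ (by norm_num) (by norm_num)]
          norm_num
  -- `C_r ≤ K'' S^{5/6}`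
  set K'' : ℝ≥0 := K' * (6 + 2 * c) with hK''
  have hCr : Cr ≤ (K'' : ℝ≥0∞) * S ^ (5 / 6 : ℝ) := by
    refine hC.trans ?_
    calc (K' : ℝ≥0∞) * (C3 ^ (2 / 3 : ℝ) + E3 ^ (1 / 2 : ℝ) * C3 ^ (1 / 3 : ℝ))
        ≤ (K' : ℝ≥0∞) * (4 * S ^ (5 / 6 : ℝ) + (2 * (c + 1) : ℝ≥0∞) * S ^ (5 / 6 : ℝ)) := by
          gcongr
      _ = (K'' : ℝ≥0∞) * S ^ (5 / 6 : ℝ) := by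
          rw [hK'']
          push_cast
          ring
  -- Young
  refine hCr.trans ((coe_mul_rpow_five_sixths_le K'' δ hδ S).trans ?_)
  rw [hSdef, hK'', hcdef]
  have e : (δ : ℝ≥0∞) * (1 + X + Y) = δ * (X + Y) + δ := by ring
  rw [e, add_assoc]

/-! ## The iteration -/

/-- **Dyadic positioning**: for `0 < ρ ≤ R₀` and `0 < κ < 1` there is `k` with
`κ^{k+1} R₀ < ρ ≤ κ^k R₀`. [folklore] -/
theorem exists_pow_mul_near {κ R₀ ρ : ℝ} (hκ : 0 < κ) (hκ1 : κ < 1) (hR₀ : 0 < R₀) (hρ : 0 < ρ)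
    (hρR : ρ ≤ R₀) : ∃ k : ℕ, κ ^ (k + 1) * R₀ < ρ ∧ ρ ≤ κ ^ k * R₀ := by
  obtain ⟨k, hk1, hk2⟩ := exists_nat_pow_near_of_lt_one (div_pos hρ hR₀)
    ((div_le_one hR₀).2 hρR) hκ hκ1
  refine ⟨k, ?_, ?_⟩
  · rwa [lt_div_iff₀ hR₀] at hk1
  · rwa [div_le_iff₀ hR₀] at hk2

/-- **The iteration of Wang–Zhang 2017, Lemma 4.1** ("a standard iterative scheme ensures that for
`0 < r < 1/2`, `F(r) = C(u,r) + D(π,r) ≤ C(M, C(u,1/2), D(π,1/2))`"), in abstract form. Let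
`C, D : ℝ → [0, ∞]` (the scaled quantities at a fixed apex as functions of the radius) satisfy on
`]0, R₀]`: the monotonicity `C(r) ≤ (R/r)² C(R)`, `D(r) ≤ (R/r)² D(R)` for `r ≤ R`; the cubic step
`C(r) ≤ δ (C(6r) + D(6r)) + (δ + K_c⁶/δ⁵)` for all `δ > 0` whenever `6r ≤ R₀`; and the pressure
decay `D(ϱ) ≤ c_p ((ϱ/ρ) D(ρ) + (ρ/ϱ)² C(ρ))` for `ϱ ≤ ρ ≤ R₀`. Then
`C(ρ) + D(ρ) ≤ A₁ (C(R₀) + D(R₀)) + A₂` for all `0 < ρ ≤ R₀`, with `A₁, A₂ < ∞` depending only on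
`c_p, K_c`. [cite: WangZhang2016, Lemma 4.1 (iteration)] -/
theorem exists_bound_of_cubic_step_of_pressure_decay (cp Kc : ℝ≥0) :
    ∃ A₁ A₂ : ℝ≥0, ∀ (C D : ℝ → ℝ≥0∞) (R₀ : ℝ), 0 < R₀ →
      (∀ r R : ℝ, 0 < r → r ≤ R → R ≤ R₀ → C r ≤ ENNReal.ofReal (R / r) ^ 2 * C R) →
      (∀ r R : ℝ, 0 < r → r ≤ R → R ≤ R₀ → D r ≤ ENNReal.ofReal (R / r) ^ 2 * D R) →
      (∀ r : ℝ, 0 < r → 6 * r ≤ R₀ → ∀ δ : ℝ≥0, 0 < δ →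
        C r ≤ δ * (C (6 * r) + D (6 * r)) + ((δ : ℝ≥0∞) + ((Kc ^ 6 / δ ^ 5 : ℝ≥0) : ℝ≥0∞))) →
      (∀ ϱ ρ : ℝ, 0 < ϱ → ϱ ≤ ρ → ρ ≤ R₀ →
        D ϱ ≤ cp * (ENNReal.ofReal (ϱ / ρ) * D ρ + ENNReal.ofReal ((ρ / ϱ) ^ 2) * C ρ)) →
      ∀ ρ ∈ Ioc 0 R₀, C ρ + D ρ ≤ A₁ * (C R₀ + D R₀) + A₂ := by
  -- ### the ratio `θ` and the constants
  set θ : ℝ := (2 * (1 + 37 * (cp : ℝ)))⁻¹ with hθdef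
  have hθpos : 0 < θ := by rw [hθdef]; positivity
  have hθhalf : θ ≤ 1 / 2 := by
    rw [hθdef, inv_le_comm₀ (by positivity) (by norm_num)]
    have : (0 : ℝ) ≤ 37 * (cp : ℝ) := by positivity
    linarith
  have hθ1 : θ ≤ 1 := hθhalf.trans (by norm_num)
  have hθkey : θ * (1 + 37 * (cp : ℝ)) = 1 / 2 := by
    rw [hθdef]; field_simp
  set δ : ℝ≥0 := ⟨θ ^ 3, by positivity⟩ with hδdef
  have hδpos : 0 < δ := by
    rw [hδdef, ← NNReal.coe_pos]
    show (0 : ℝ) < θ ^ 3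
    positivity
  -- the additive constant of the cubic step at `δ = θ³`
  set cδ : ℝ≥0∞ := (δ : ℝ≥0∞) + ((Kc ^ 6 / δ ^ 5 : ℝ≥0) : ℝ≥0∞) with hcδ
  have hcδtop : cδ ≠ ⊤ := ENNReal.add_ne_top.2 ⟨ENNReal.coe_ne_top, ENNReal.coe_ne_top⟩
  -- the additive constant of one contraction step
  set c'' : ℝ≥0∞ := cδ * (1 + cp * ENNReal.ofReal (θ⁻¹ ^ 2)) with hc''
  have hc''top : c'' ≠ ⊤ := ENNReal.mul_ne_top hcδtop
    (ENNReal.add_ne_top.2 ⟨ENNReal.one_ne_top, ENNReal.mul_ne_top ENNReal.coe_ne_top ENNReal.ofReal_ne_top⟩)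
  set κ : ℝ := θ / 6 with hκdef
  have hκpos : 0 < κ := by rw [hκdef]; positivity
  have hκ1 : κ < 1 := by rw [hκdef]; linarith
  refine ⟨(ENNReal.ofReal (κ⁻¹ ^ 2)).toNNReal, (ENNReal.ofReal (κ⁻¹ ^ 2) * (2 * c'')).toNNReal, ?_⟩
  intro C D R₀ hR₀ hmonoC hmonoD hstep hPD ρ hρ
  rw [ENNReal.coe_toNNReal ENNReal.ofReal_ne_top,
    ENNReal.coe_toNNReal (ENNReal.mul_ne_top ENNReal.ofReal_ne_top (ENNReal.mul_ne_top (by simp) hc''top))]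
  set F : ℝ → ℝ≥0∞ := fun r => C r + D r with hFdef
  -- ### one contraction step: `F(θR/6) ≤ F(R)/2 + c''` for `0 < R ≤ R₀`
  have hcontract : ∀ R : ℝ, 0 < R → R ≤ R₀ → F (κ * R) ≤ 2⁻¹ * F R + c'' := by
    intro R hR hRR₀
    have hr : 0 < κ * R := mul_pos hκpos hR
    have h6r : 6 * (κ * R) = θ * R := by rw [hκdef]; ring
    have hθR : 0 < θ * R := mul_pos hθpos hR
    have hθRle : θ * R ≤ R := mul_le_of_le_one_left hR.le hθ1
    -- monotonicity factors
    have hmC : C (θ * R) ≤ ENNReal.ofReal (θ⁻¹ ^ 2) * C R := by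
      have h := hmonoC (θ * R) R hθR hθRle hRR₀
      rwa [← ENNReal.ofReal_pow (by positivity), show R / (θ * R) = θ⁻¹ by field_simp] at h
    have hmD : D (θ * R) ≤ ENNReal.ofReal (θ⁻¹ ^ 2) * D R := by
      have h := hmonoD (θ * R) R hθR hθRle hRR₀
      rwa [← ENNReal.ofReal_pow (by positivity), show R / (θ * R) = θ⁻¹ by field_simp] at h
    have hδθ : (δ : ℝ≥0∞) * ENNReal.ofReal (θ⁻¹ ^ 2) = ENNReal.ofReal θ := by
      have e : (δ : ℝ≥0∞) = ENNReal.ofReal (θ ^ 3) := by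
        rw [← ENNReal.ofReal_coe_nnreal]
        rfl
      rw [e, ← ENNReal.ofReal_mul (by positivity)]
      congr 1
      field_simp
    have hcp : (cp : ℝ≥0∞) = ENNReal.ofReal (cp : ℝ) := (ENNReal.ofReal_coe_nnreal).symm
    -- the cubic step at `r = κR` (`6r = θR`)
    have hC1 : C (κ * R) ≤ ENNReal.ofReal θ * F R + cδ := by
      have h := hstep (κ * R) hr (by rw [h6r]; exact hθRle.trans hRR₀) δ hδpos
      rw [h6r] at h
      refine h.trans ?_
      rw [← hcδ]
      gcongr ?_ + _
      calc (δ : ℝ≥0∞) * (C (θ * R) + D (θ * R))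
          ≤ δ * (ENNReal.ofReal (θ⁻¹ ^ 2) * C R + ENNReal.ofReal (θ⁻¹ ^ 2) * D R) := by gcongr
        _ = ((δ : ℝ≥0∞) * ENNReal.ofReal (θ⁻¹ ^ 2)) * F R := by rw [hFdef]; ring
        _ = ENNReal.ofReal θ * F R := by rw [hδθ]
    -- the cubic step at `r = R/6`
    have hC6 : C (R / 6) ≤ (δ : ℝ≥0∞) * F R + cδ := by
      have h := hstep (R / 6) (by positivity) (by linarith) δ hδpos
      rw [show 6 * (R / 6) = R by ring] at h
      exact h
    -- the pressure decay from `R/6` to `κR = θ (R/6)`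
    have hD1 : D (κ * R) ≤ cp * (ENNReal.ofReal θ * (36 * D R) +
        ENNReal.ofReal (θ⁻¹ ^ 2) * ((δ : ℝ≥0∞) * F R + cδ)) := by
      have h := hPD (κ * R) (R / 6) hr (by rw [hκdef]; nlinarith) (by linarith)
      have e1 : κ * R / (R / 6) = θ := by rw [hκdef]; field_simp
      have e2 : (R / 6 / (κ * R)) ^ 2 = θ⁻¹ ^ 2 := by rw [hκdef]; field_simp
      rw [e1, e2] at h
      refine h.trans ?_
      have hD6 : D (R / 6) ≤ 36 * D R := by
        have h' := hmonoD (R / 6) R (by positivity) (by linarith) hRR₀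
        rwa [show R / (R / 6) = 6 by field_simp, ENNReal.ofReal_ofNat, show ((6 : ℝ≥0∞)) ^ 2 = 36 by norm_num] at h'
      gcongr
    -- summing up
    have hDF : D R ≤ F R := le_add_self
    calc F (κ * R) = C (κ * R) + D (κ * R) := rfl
      _ ≤ (ENNReal.ofReal θ * F R + cδ) + cp * (ENNReal.ofReal θ * (36 * D R) +
          ENNReal.ofReal (θ⁻¹ ^ 2) * ((δ : ℝ≥0∞) * F R + cδ)) := add_le_add hC1 hD1
      _ ≤ (ENNReal.ofReal θ * F R + cδ) + cp * (ENNReal.ofReal θ * (36 * F R) +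
          ENNReal.ofReal (θ⁻¹ ^ 2) * ((δ : ℝ≥0∞) * F R + cδ)) := by gcongr
      _ = (ENNReal.ofReal θ * (1 + 37 * cp)) * F R + cδ * (1 + cp * ENNReal.ofReal (θ⁻¹ ^ 2)) := by
          have e : (cp : ℝ≥0∞) * (ENNReal.ofReal (θ⁻¹ ^ 2) * ((δ : ℝ≥0∞) * F R)) =
              cp * (((δ : ℝ≥0∞) * ENNReal.ofReal (θ⁻¹ ^ 2)) * F R) := by ring
          rw [mul_add (cp : ℝ≥0∞), mul_add (ENNReal.ofReal (θ⁻¹ ^ 2)), mul_add (cp : ℝ≥0∞), e, hδθ]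
          ring
      _ = 2⁻¹ * F R + c'' := by
          rw [hc'', hcp, ← ENNReal.ofReal_ofNat 37, ← ENNReal.ofReal_one,
            ← ENNReal.ofReal_mul (by norm_num), ← ENNReal.ofReal_add (by norm_num) (by positivity),
            ← ENNReal.ofReal_mul hθpos.le, hθkey, ENNReal.ofReal_one, one_div,
            ENNReal.ofReal_inv_of_pos two_pos, ENNReal.ofReal_ofNat]
  -- ### the iteration along `κ^k R₀`
  have hiter : ∀ k : ℕ, F (κ ^ k * R₀) ≤ F R₀ + 2 * c'' := by
    intro k
    induction k with
    | zero => rw [pow_zero, one_mul]; exact le_self_add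
    | succ k ih =>
        have hRk : 0 < κ ^ k * R₀ := by positivity
        have hRk1 : κ ^ k * R₀ ≤ R₀ := mul_le_of_le_one_left hR₀.le (pow_le_one₀ hκpos.le hκ1.le)
        calc F (κ ^ (k + 1) * R₀) = F (κ * (κ ^ k * R₀)) := by rw [pow_succ]; ring_nf
          _ ≤ 2⁻¹ * F (κ ^ k * R₀) + c'' := hcontract _ hRk hRk1
          _ ≤ 2⁻¹ * (F R₀ + 2 * c'') + c'' := by gcongr
          _ = 2⁻¹ * F R₀ + 2 * c'' := by
              rw [mul_add, ← mul_assoc, ENNReal.inv_mul_cancel two_ne_zero ENNReal.ofNat_ne_top, one_mul,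
                add_assoc, ← two_mul]
          _ ≤ F R₀ + 2 * c'' := by
              gcongr
              calc 2⁻¹ * F R₀ ≤ 1 * F R₀ := mul_le_mul' (ENNReal.inv_le_one.2 one_le_two) le_rfl
                _ = F R₀ := one_mul _
  -- ### positioning of `ρ`
  have hρpos : 0 < ρ := hρ.1
  obtain ⟨k, hk1, hk2⟩ := exists_pow_mul_near hκpos hκ1 hR₀ hρpos hρ.2
  have hRk : 0 < κ ^ k * R₀ := by positivity
  have hRk1 : κ ^ k * R₀ ≤ R₀ := mul_le_of_le_one_left hR₀.le (pow_le_one₀ hκpos.le hκ1.le)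
  have hratio : κ ^ k * R₀ / ρ ≤ κ⁻¹ := by
    rw [div_le_iff₀ hρ.1]
    have h : κ * (κ ^ k * R₀) < ρ := by rw [pow_succ] at hk1; linarith [hk1]
    have h' : κ ^ k * R₀ < κ⁻¹ * ρ := by
      rw [← div_eq_inv_mul, lt_div_iff₀ hκpos]; linarith
    exact h'.le
  have hmF : F ρ ≤ ENNReal.ofReal (κ⁻¹ ^ 2) * F (κ ^ k * R₀) := by
    have h1 := hmonoC ρ (κ ^ k * R₀) hρ.1 hk2 hRk1
    have h2 := hmonoD ρ (κ ^ k * R₀) hρ.1 hk2 hRk1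
    have hfac : ENNReal.ofReal (κ ^ k * R₀ / ρ) ^ 2 ≤ ENNReal.ofReal (κ⁻¹ ^ 2) := by
      rw [← ENNReal.ofReal_pow (by positivity)]
      exact ENNReal.ofReal_le_ofReal (pow_le_pow_left₀ (by positivity) hratio 2)
    calc F ρ = C ρ + D ρ := rfl
      _ ≤ ENNReal.ofReal (κ ^ k * R₀ / ρ) ^ 2 * C (κ ^ k * R₀) +
          ENNReal.ofReal (κ ^ k * R₀ / ρ) ^ 2 * D (κ ^ k * R₀) := add_le_add h1 h2
      _ = ENNReal.ofReal (κ ^ k * R₀ / ρ) ^ 2 * F (κ ^ k * R₀) := by rw [hFdef]; ring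
      _ ≤ ENNReal.ofReal (κ⁻¹ ^ 2) * F (κ ^ k * R₀) := mul_le_mul' hfac le_rfl
  calc C ρ + D ρ = F ρ := rfl
    _ ≤ ENNReal.ofReal (κ⁻¹ ^ 2) * F (κ ^ k * R₀) := hmF
    _ ≤ ENNReal.ofReal (κ⁻¹ ^ 2) * (F R₀ + 2 * c'') := mul_le_mul' le_rfl (hiter k)
    _ = ENNReal.ofReal (κ⁻¹ ^ 2) * (C R₀ + D R₀) + ENNReal.ofReal (κ⁻¹ ^ 2) * (2 * c'') := by
        rw [hFdef]; ring


/-! ## The uniform bounds for classical solutions -/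

section Classical

set_option maxHeartbeats 3200000 in
/-- **Wang–Zhang 2017, Lemma 4.1 (with (4.1)): uniform scale-invariant bounds.** Let `(u, p)` be a
classical solution of the unit-viscosity unforced Navier–Stokes system on `ℝ³ × [0, T)`,
Leray–Hopf from its datum, whose slices are represented by tempered distributions `U t` with
`‖U t‖_{Ḃ^{-1+3/p}_{p,q}} ≤ M` (`3 < p < ∞`, `q ≠ 0`). Then there are `K < ∞` and `R₁ > 0`
(`4R₁² ≤ T/2`) such that for every apex `(t₀, x₀)` with `T/2 ≤ t₀ ≤ T` and every `0 < ρ ≤ R₁`,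
`A(ρ) + E(ρ) + C(ρ) + D(ρ) ≤ K` at `(t₀, x₀)` — `A = cknAEss`, `E = cknE` with the classical
gradient, `C = cknC`, `D = cknD` of the gauged pressure `p - (p(·,0) - p̃[u](0))`. Proof in the
module docstring. [cite: WangZhang2016, Lemma 4.1 and §4 Step 1 (4.1)] -/
theorem exists_scaledEnergies_bounded_of_classical_besov
    {u : ℝ → EuclideanSpace ℝ (Fin 3) → EuclideanSpace ℝ (Fin 3)}
    {p : ℝ → EuclideanSpace ℝ (Fin 3) → ℝ}
    {U : ℝ → 𝓢'(EuclideanSpace ℝ (Fin 3), EuclideanSpace ℂ (Fin 3))}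
    {r q : ℝ≥0∞} [Fact (1 ≤ r)] (hr3 : 3 < r) (hr : r ≠ ⊤) (hq : q ≠ 0) {T : ℝ} (hT : 0 < T)
    {M : ℝ≥0} (hsol : IsClassicalNSSolutionOn (Ico 0 T) 1 0 u p)
    (hLH : IsLerayHopfOn T 1 0 (u 0) u)
    (hU : ∀ t ∈ Ico 0 T, IsDistributionOf (u t) (U t))
    (hM : ∀ t ∈ Ico 0 T, FunctionSpaces.eHomBesovNorm (-1 + 3 / r.toReal) r q (U t) ≤ M) :
    ∃ (K : ℝ≥0) (R₁ : ℝ), 0 < R₁ ∧ 4 * R₁ ^ 2 ≤ T / 2 ∧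
      ∀ t₀ ∈ Icc (T / 2) T, ∀ (x₀ : EuclideanSpace ℝ (Fin 3)), ∀ ρ ∈ Ioc 0 R₁,
        cknAEss ρ (t₀, x₀) u + cknE ρ (t₀, x₀) (fun t x => fderiv ℝ (u t) x) +
          cknC ρ (t₀, x₀) u +
          cknD ρ (t₀, x₀) (fun t x => p t x - (p t 0 - normalisedPressure (u t) 0)) ≤ K := by
  classical
  -- ### the exponent `p' = max p 6` and the Besov bound in `Ḃ^{-1+3/p'}_{p',∞}`
  set p' : ℝ≥0∞ := max r 6 with hp'def
  haveI : Fact (1 ≤ p') := ⟨(Fact.out : (1 : ℝ≥0∞) ≤ r).trans (le_max_left _ _)⟩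
  have hp'6 : 6 ≤ p' := le_max_right _ _
  have hp'top : p' ≠ ⊤ := (max_lt hr.lt_top (by simp)).ne
  obtain ⟨C_E, hCE⟩ := FunctionSpaces.besov_embedding_holds (E := EuclideanSpace ℝ (Fin 3))
    (F := EuclideanSpace ℂ (Fin 3)) (-1 + 3 / r.toReal) (p := r) (r := p') (le_max_left _ _) ∞
  have hrpos : 0 < r.toReal := ENNReal.toReal_pos (by
    intro h; rw [h] at hr3; exact absurd hr3 (by simp)) hr
  have hp'pos : 0 < p'.toReal := ENNReal.toReal_pos (by
    intro h; rw [h] at hp'6; exact absurd hp'6 (by simp)) hp'top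
  have hexp : -1 + 3 / r.toReal - (Module.finrank ℝ (EuclideanSpace ℝ (Fin 3)) : ℝ) *
      (r.toReal⁻¹ - p'.toReal⁻¹) = -1 + 3 / p'.toReal := by
    rw [finrank_euclideanSpace_fin]; push_cast; ring
  set M' : ℝ≥0 := C_E * M with hM'def
  have hM' : ∀ t ∈ Ico 0 T, FunctionSpaces.eHomBesovNorm (-1 + 3 / p'.toReal) p' ∞ (U t) ≤ M' := by
    intro t ht
    have h1 := hCE (U t)
    rw [hexp] at h1
    refine h1.trans ?_
    rw [hM'def, ENNReal.coe_mul]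
    gcongr
    exact (FunctionSpaces.eHomBesovNorm_top_le_eHomBesovNorm _ _ hq _).trans (hM t ht)
  -- realisation and smoothness
  have hreal : ∀ t ∈ Ico 0 T,
      Tendsto (fun j : ℤ => FunctionSpaces.lowFreqCutoff j (U t)) atBot (𝓝 0) := fun t ht =>
    tendsto_lowFreqCutoff_of_memLp_two_holds (hLH.memLp t ⟨ht.1, ht.2.le⟩) (hU t ht)
  have hsm : IsSmoothSpaceTimeOn (Ioo 0 T) u := hsol.smooth_velocity.mono Ioo_subset_Ico_self
  -- ### the cubic estimate, the local energy bound, the pressure decay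
  obtain ⟨Kstar, hKstar⟩ := exists_cknC_le_of_eHomBesovNorm_le p' hp'6 hp'top
  obtain ⟨c₁, c₂, c₃, hLEB⟩ := Seregin2020.localEnergyBound_top
  obtain ⟨cp, hcp⟩ := seregin_sverak_pressure_decay_holds
  -- the slab, the gauged pressure, the suitable pair and the classical gradient
  set qg : ℝ → EuclideanSpace ℝ (Fin 3) → ℝ := fun t x => p t x - (p t 0 - normalisedPressure (u t) 0)
    with hqg
  set Q : Opens (ℝ × EuclideanSpace ℝ (Fin 3)) :=
    ⟨Ioo 0 T ×ˢ univ, isOpen_Ioo.prod isOpen_univ⟩ with hQdef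
  have hQ : (Q : Set (ℝ × EuclideanSpace ℝ (Fin 3))) ⊆ Ioo 0 T ×ˢ univ := Subset.rfl
  have hsw : IsSuitableWeakSolutionOn Q 1 0 u qg :=
    SereginSverak2002.isSuitableWeakSolutionOn_gauge_of_classical one_pos hT hsol hLH Q hQ
  have hG : HasWeakSpatialGradientOn Q u fun t x => fderiv ℝ (u t) x :=
    hasWeakSpatialGradientOn_of_contDiffOn isOpen_Ioo hQ (hsm.of_le (by exact_mod_cast le_top))
  -- ### the iteration constants and the radii
  set Kc : ℝ≥0 := Kstar * M' * (6 + 2 * (c₁ + c₂ + c₃)) with hKc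
  obtain ⟨A₁, A₂, hA⟩ := exists_bound_of_cubic_step_of_pressure_decay cp Kc
  set R₀ : ℝ := Real.sqrt (T / 8) with hR₀def
  have hR₀ : 0 < R₀ := Real.sqrt_pos.2 (by positivity)
  have hR₀sq : R₀ ^ 2 = T / 8 := Real.sq_sqrt (by positivity)
  -- cylinders with apex in `[T/2, T] × ℝ³` and radius `≤ R₀` lie in the slab
  have hcyl : ∀ t₀ ∈ Icc (T / 2) T, ∀ (x₀ : EuclideanSpace ℝ (Fin 3)) (R : ℝ), 0 < R → R ≤ R₀ →
      parabolicCylinder R (t₀, x₀) ⊆ (Q : Set (ℝ × EuclideanSpace ℝ (Fin 3))) := by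
    intro t₀ ht₀ x₀ R hR hRR₀ w hw
    rw [mem_parabolicCylinder] at hw
    have hR2 : R ^ 2 ≤ T / 8 := by rw [← hR₀sq]; exact pow_le_pow_left₀ hR.le hRR₀ 2
    refine ⟨⟨?_, ?_⟩, mem_univ _⟩
    · have := hw.1.1; dsimp only at this; linarith [ht₀.1]
    · have := hw.1.2; dsimp only at this; linarith [ht₀.2]
  -- ### the slab integrals bound the top-scale quantities, uniformly in the apex
  set I₃ : ℝ≥0∞ := ∫⁻ w in Ioo 0 T ×ˢ (univ : Set (EuclideanSpace ℝ (Fin 3))), ‖u w.1 w.2‖ₑ ^ (3 : ℕ)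
    with hI₃
  set I₂ : ℝ≥0∞ := ∫⁻ w in Ioo 0 T ×ˢ (univ : Set (EuclideanSpace ℝ (Fin 3))), ‖qg w.1 w.2‖ₑ ^ (3 / 2 : ℝ)
    with hI₂
  have hI₃top : I₃ < ⊤ := SereginSverak2002.lintegral_slab_enorm_pow_three_lt_top one_pos hLH
  have hI₂top : I₂ < ⊤ := by
    have h := SereginSverak2002.lintegral_slab_gauged_pressure_lt_top one_pos hT hsol hLH
    exact h
  set F₀ : ℝ≥0∞ := (ENNReal.ofReal R₀ ^ 2)⁻¹ * (I₃ + I₂) with hF₀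
  have hF₀top : F₀ ≠ ⊤ := ENNReal.mul_ne_top
    (ENNReal.inv_ne_top.2 (pow_ne_zero _ (ENNReal.ofReal_pos.2 hR₀).ne'))
    (ENNReal.add_ne_top.2 ⟨hI₃top.ne, hI₂top.ne⟩)
  have htopC : ∀ t₀ ∈ Icc (T / 2) T, ∀ (x₀ : EuclideanSpace ℝ (Fin 3)),
      cknC R₀ (t₀, x₀) u ≤ (ENNReal.ofReal R₀ ^ 2)⁻¹ * I₃ := fun t₀ ht₀ x₀ =>
    mul_le_mul' le_rfl (lintegral_mono_set (hcyl t₀ ht₀ x₀ R₀ hR₀ le_rfl))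
  have htopD : ∀ t₀ ∈ Icc (T / 2) T, ∀ (x₀ : EuclideanSpace ℝ (Fin 3)),
      cknD R₀ (t₀, x₀) qg ≤ (ENNReal.ofReal R₀ ^ 2)⁻¹ * I₂ := fun t₀ ht₀ x₀ =>
    mul_le_mul' le_rfl (lintegral_mono_set (hcyl t₀ ht₀ x₀ R₀ hR₀ le_rfl))
  have htopF : ∀ t₀ ∈ Icc (T / 2) T, ∀ (x₀ : EuclideanSpace ℝ (Fin 3)),
      cknC R₀ (t₀, x₀) u + cknD R₀ (t₀, x₀) qg ≤ F₀ := by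
    intro t₀ ht₀ x₀
    rw [hF₀, mul_add]
    exact add_le_add (htopC t₀ ht₀ x₀) (htopD t₀ ht₀ x₀)
  -- ### the hypotheses of the abstract iteration, at every admissible apex
  have hbound : ∀ t₀ ∈ Icc (T / 2) T, ∀ (x₀ : EuclideanSpace ℝ (Fin 3)), ∀ ρ ∈ Ioc 0 R₀,
      cknC ρ (t₀, x₀) u + cknD ρ (t₀, x₀) qg ≤ A₁ * F₀ + A₂ := by
    intro t₀ ht₀ x₀ ρ hρ
    set z : ℝ × EuclideanSpace ℝ (Fin 3) := (t₀, x₀) with hz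
    have ht₀pos : 0 < t₀ := by linarith [ht₀.1]
    -- monotonicity
    have hmonoC : ∀ r' R : ℝ, 0 < r' → r' ≤ R → R ≤ R₀ →
        cknC r' z u ≤ ENNReal.ofReal (R / r') ^ 2 * cknC R z u := fun r' R hr' hrR _ =>
      Seregin2020.cknC_le_mul_of_subset (hr'.trans_le hrR) hr' (parabolicCylinder_mono hr'.le hrR z) u
    have hmonoD : ∀ r' R : ℝ, 0 < r' → r' ≤ R → R ≤ R₀ →
        cknD r' z qg ≤ ENNReal.ofReal (R / r') ^ 2 * cknD R z qg := fun r' R hr' hrR _ =>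
      cknD_le_mul_of_subset (hr'.trans_le hrR) hr' (parabolicCylinder_mono hr'.le hrR z) qg
    -- the cubic step
    have hstep : ∀ r' : ℝ, 0 < r' → 6 * r' ≤ R₀ → ∀ δ : ℝ≥0, 0 < δ →
        cknC r' z u ≤ δ * (cknC (6 * r') z u + cknD (6 * r') z qg) +
          ((δ : ℝ≥0∞) + ((Kc ^ 6 / δ ^ 5 : ℝ≥0) : ℝ≥0∞)) := by
      intro r' hr' h6r' δ hδ
      -- the cubic estimate on `]0, t₀[`
      have hsm' : IsSmoothSpaceTimeOn (Ioo 0 t₀) u := hsm.mono (Ioo_subset_Ioo le_rfl ht₀.2)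
      have ha : (0 : ℝ) ≤ t₀ - (3 * r') ^ 2 := by
        have : (3 * r') ^ 2 ≤ R₀ ^ 2 := by nlinarith
        rw [hR₀sq] at this
        linarith [ht₀.1]
      have hstar := hKstar u U M' 0 t₀ x₀ r' hr' ha hsm'
        (fun t ht => hU t ⟨ht.1.le, ht.2.trans_le ht₀.2⟩)
        (fun t ht => hreal t ⟨ht.1.le, ht.2.trans_le ht₀.2⟩)
        (fun t ht => hM' t ⟨ht.1.le, ht.2.trans_le ht₀.2⟩)
      -- the local energy bound at `R = 6r'`
      have h6 : (0 : ℝ) < 6 * r' := by positivity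
      have hLEB' := hLEB Q u qg _ hsw hG z (6 * r') h6 (hcyl t₀ ht₀ x₀ _ h6 h6r')
      rw [show 6 * r' / 2 = 3 * r' by ring] at hLEB'
      have hE3 : cknE (3 * r') z (fun t x => fderiv ℝ (u t) x) ≤
          c₁ * cknC (6 * r') z u ^ (2 / 3 : ℝ) + c₂ * cknC (6 * r') z u +
            c₃ * (cknD (6 * r') z qg ^ (2 / 3 : ℝ) * cknC (6 * r') z u ^ (1 / 3 : ℝ)) :=
        le_add_self.trans hLEB'
      have hC3 : cknC (3 * r') z u ≤ 4 * cknC (6 * r') z u := by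
        have h := Seregin2020.cknC_le_mul_of_subset h6 (by positivity : (0 : ℝ) < 3 * r')
          (parabolicCylinder_mono (by positivity) (by linarith) z) u
        rwa [show 6 * r' / (3 * r') = 2 by field_simp; ring, ENNReal.ofReal_ofNat,
          show ((2 : ℝ≥0∞)) ^ 2 = 4 by norm_num] at h
      have h := le_delta_mul_add_of_cubic_estimate (K' := Kstar * M') (by push_cast at hstar ⊢; exact hstar)
        hE3 hC3 hδ
      rw [hKc]
      exact h
    -- the pressure decay
    have hPD : ∀ ϱ ρ' : ℝ, 0 < ϱ → ϱ ≤ ρ' → ρ' ≤ R₀ →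
        cknD ϱ z qg ≤ cp * (ENNReal.ofReal (ϱ / ρ') * cknD ρ' z qg +
          ENNReal.ofReal ((ρ' / ϱ) ^ 2) * cknC ρ' z u) := fun ϱ ρ' hϱ hϱρ hρR₀ =>
      hcp Q u qg hsw.distributional z ρ' ϱ hϱ hϱρ (hcyl t₀ ht₀ x₀ ρ' (hϱ.trans_le hϱρ) hρR₀)
    have h := hA (fun ρ => cknC ρ z u) (fun ρ => cknD ρ z qg) R₀ hR₀ hmonoC hmonoD hstep hPD ρ hρ
    exact h.trans (add_le_add (mul_le_mul' le_rfl (htopF t₀ ht₀ x₀)) le_rfl)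
  -- ### conclusion through Seregin's lemma
  set B : ℝ≥0∞ := A₁ * F₀ + A₂ with hB
  have hBtop : B ≠ ⊤ := ENNReal.add_ne_top.2 ⟨ENNReal.mul_ne_top ENNReal.coe_ne_top hF₀top,
    ENNReal.coe_ne_top⟩
  obtain ⟨K, hK⟩ := Seregin2020.scaledEnergies_bounded_of_cknC_le_unif B.toNNReal F₀.toNNReal
  refine ⟨K, R₀ / 2, by positivity, ?_, ?_⟩
  · nlinarith [hR₀sq]
  intro t₀ ht₀ x₀ ρ hρ
  refine hK Q u qg _ hsw hG (t₀, x₀) R₀ hR₀ (hcyl t₀ ht₀ x₀ R₀ hR₀ le_rfl) ?_ ?_ ρ hρ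
  · rw [ENNReal.coe_toNNReal hF₀top]
    exact le_add_self.trans (htopF t₀ ht₀ x₀)
  · intro ρ' hρ'
    rw [ENNReal.coe_toNNReal hBtop]
    exact le_self_add.trans (hbound t₀ ht₀ x₀ ρ' hρ')

end Classical

end Literature.Analysis.FluidPDE

end
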